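import Summits.Ventures.HSemireg.Pad4TowerLinePhaseRigidityNucleus1

/-!
# Pad4Tower ∕ LinePhaseRigidity — Part J (2∕2) THE UNIT NUCLEUS BELOW TWELVE IS EMPTY: `two_units3_absent`, `units4_odd_absent` ⇒ `abstractOddUnitNucleusFree_of_lt_twelve` ⇒ **`oddFCFreeLine_of_lt_twelve`** (every `h < 12`) and **`oddLineThresholdLaw_holds : OddLineThresholdLaw`** (PROVED outright)
# (HSemireg support file; PT-PORT-2 (a3), tree copy of control's crux workfile)

Crux of record: `Summit.HodgeConjecture.HodgeConjecture.Theses.EightfoldBlochSeeds.BlochSeedDiscOne` (= `HasHyperbolicBlochSeed 4 1`, item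
stmt-HodgeConjecture-18881; skeleton `Cruxes/BlochSeedDiscOne/Lines/birth.lean` 814a6a70c14e831a, STUB R `stub_rung_pad4_seedAt`, UNTOUCHED).
Nothing in this file proves HC, HC_AV, HC_CM, H2, item 18881, (T₈) or (T₁₀); census-neutral (no SAT∕UNSAT row is added or changed). Statements about
the typed FIRST-ORDER static game on the LINE alphabet of the PAD-4 design tower (`RuleDMu4Closed`, `XPlusClosed`, `G1Closed` of record) — H₁-static
letter DESIGNS, not sheaves, monads or seeds; HC_CM is a displayed binder of the ladder only, unused here.

PROVENANCE. TREE COPY — statements AND proofs verbatim; new are only the namespace `Summit.Ventures.HSemireg.Pad4Tower.LinePhaseRigidity`, this module docstring, the module boundary, the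
`open` of the tree toolkit namespace `…Pad4Tower.LineInertia` (= the workfile's Part A), one-line docstrings where the gate requires them, and ONE dedup
to the tree the key allows: Part J's `fin4_add_two_ne : ∀ k : Fin 4, k + 2 ≠ k` is NOT re-declared — its uses call the toolkit's identical `LineInertia.add_two_ne` —
of Part J, second half (from `two_units3_absent`) of the crux workfile `Cruxes/BlochSeedDiscOne/LinePhaseRigidity.lean` v1.9 (author plan-lens-HodgeAV-control g9; crux commit f5c30e1c3066, sha16 f0ad6d2122a71d9c; critic plates idea-crit-6 g15 PASS). Filed in the tree on plan-lens-HodgeAV-control g10's KEY (a3) (bus l.10147: «Parts G–L up to `oddFCFreeLine_of_lt_twelve`,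
`not_oddFCFreeLine_twelve`, `fcShapeLine_of_lt_twelve` → tree, so that `DiamondLevelLaws.OddLineFree h` (∀ h < 12) is a tree theorem and the displayed
hypothesis of `oddThreshold_iff_lineNest` is discharged by name») by hsemireg-phasetorus-typer-1 g3. Module set of (a3), each importing the previous, on top of
(a2)'s `Pad4TowerLinePhaseRigidityGap`: `Pad4TowerLinePhaseRigidityTags` (Part G) → `…Parity` (Parts H, I) → `…Nucleus1` (Part J, first half) → `…Nucleus2` (Part J, second half: `oddFCFreeLine_of_lt_twelve`, `oddLineThresholdLaw_holds`) → `…PhaseType` (Part K) → `…Shape` (Part L: `fcShapeLine_of_lt_twelve`). 0 sorry, 0 named facts, no instance ∕ notation ∕ set_option ∕ native_decide; docstring on every declaration.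

CONTENT. In `namespace LineModel` (`h < 12`): `two_units3_absent`, `units4_odd_absent`; then `odd_unit_tags_aux`∕`odd_unit_tags`, `abstractOddUnitNucleusFree_of_lt_twelve`, `abstractOddFree_of_lt_twelve`, **`oddFCFreeLine_of_lt_twelve`**, **`oddLineThresholdLaw_holds`** — with `…Units.not_oddFCFreeLine_twelve` the odd threshold on the LINE is `h ≥ 12` exactly, in the tree.
-/

namespace Summit.Ventures.HSemireg.Pad4Tower.LinePhaseRigidity

open Finset Summit.Ventures.HSemireg.Pad4Tower Summit.Ventures.HSemireg.LinePhaseTorus Summit.Ventures.HSemireg.Pad4Tower.LineInertia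

namespace LineModel

variable {h : ℤ} {vN vP : ACell → Prop}


/-- **THE `(2;1,1,1)` CELLS ARE ABSENT below twelve (PROVED)**: `P[1_k,1_k,1_k,2_{k'}]` with `k' ≠ k`.  Chain: the FC shadow
`N[1,1,1,1_{k'}]` is `fcN_tags_const`-dead, so RD-P at the `2`-letter lands on the apex (`N000`); RD-P at a unit gives `N'`; raising a unit
of `N'` lands at charge `2` (`V'`); the unit shadow of `V'` at the `2_{k'}`-letter is `n3_tags`-dead, so `two_sibling` kills `V'[d ≔ 1_k]`,
whence `w_of` gives `W`; but raising the `2_{k'}`-letter of `N'` gives `Z`, which `z_absent` forbids. -/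
theorem two_units3_absent (M : LineModel h vN vP) (hh : h < 12) {T : ACell} (hT : vP T) {a b c d : Fin 4} (hab : a ≠ b)
    (hac : a ≠ c) (had : a ≠ d) (hbc : b ≠ c) (hbd : b ≠ d) (hcd : c ≠ d) (ha1 : (T a).1 = 1) (hb1 : (T b).1 = 1)
    (hc1 : (T c).1 = 1) (hd2 : (T d).1 = 2) (hb2 : (T b).2 = (T a).2) (hc2 : (T c).2 = (T a).2) (hne : (T d).2 ≠ (T a).2) :
    False := by
  set k : Fin 4 := (T a).2 with hk
  set t : Fin 4 := (T d).2 - k with htk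
  have ht : t ≠ 0 := fun e => hne (sub_eq_zero.mp e)
  have hkt : k + t ≠ k := fin4_add_ne_of_ne_zero k t ht
  have ha : T a = (1, k) := Prod.ext ha1 rfl
  have hb : T b = (1, k) := Prod.ext hb1 hb2
  have hc : T c = (1, k) := Prod.ext hc1 hc2
  have hd : T d = (2, k + t) := Prod.ext hd2 (by rw [htk]; abel)
  -- C1: the FC shadow is absent
  have C1 : ¬ vN (Function.update T d (1, k + t)) := by
    intro hN
    have := M.fcN_tags_const hN (fun f => ?_) hh d a
    · rw [Function.update_self, Function.update_of_ne had, ha] at this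
      exact hkt this
    · rcases fin4_cover hab hac had hbc hbd hcd f with hf | hf | hf | hf <;> rw [hf]
      · rw [Function.update_of_ne had, ha]
      · rw [Function.update_of_ne hbd, hb]
      · rw [Function.update_of_ne hcd, hc]
      · rw [Function.update_self]
  -- C2: `N000 = T[d ≔ apex]`
  obtain ⟨c₀, h0lt, hN000⟩ := M.rdP T hT d (one_le_of_eq_two hd2)
  rw [hd2] at h0lt
  rw [show (T d).2 = k + t by rw [hd]] at hN000
  have hc₀ : c₀ = 0 := by
    rcases (by omega : c₀ = 0 ∨ c₀ = 1) with e | e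
    · exact e
    · exfalso; subst e; exact C1 hN000
  subst hc₀
  -- C3: `N' = T[a ≔ apex]`
  have hN' := M.unit_hub hT ha1 k
  have e_b : Function.update T a (0, k) b = (1, k) := by rw [Function.update_of_ne hab.symm, hb]
  have e_c : Function.update T a (0, k) c = (1, k) := by rw [Function.update_of_ne hac.symm, hc]
  have e_d : Function.update T a (0, k) d = (2, k + t) := by rw [Function.update_of_ne had.symm, hd]
  have e_a : (Function.update T a (0, k) a).1 = 0 := by rw [Function.update_self]
  -- C4: raise `b` in `N'` to exactly `2`
  obtain ⟨c₁, h1lt, h1le, hV', h1t⟩ := M.raise3 hh hN' (g := b) (a := c) (b := d) (f := a) hbc hbd hab.symm hcd hac.symm had.symm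
    (one_le_of_eq_one (by rw [e_b])) (one_le_of_eq_one (by rw [e_c])) (one_le_of_eq_two (by rw [e_d])) e_a
  rw [show (Function.update T a (0, k) b).1 = 1 by rw [e_b]] at h1lt
  have hc₁ : c₁ = 2 := by
    rcases (by omega : c₁ = 2 ∨ c₁ = 3) with e | e
    · exact e
    · exfalso; have := h1t e; rw [e_c, e_d] at this; exact hkt this.symm
  subst hc₁
  rw [show (Function.update T a (0, k) b).2 = k by rw [e_b]] at hV'
  have eVa : (Function.update (Function.update T a (0, k)) b (2, k) a).1 = 0 := by
    rw [Function.update_of_ne hab, Function.update_self]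
  have eVb : Function.update (Function.update T a (0, k)) b (2, k) b = (2, k) := by rw [Function.update_self]
  have eVc : Function.update (Function.update T a (0, k)) b (2, k) c = (1, k) := by rw [Function.update_of_ne hbc.symm, e_c]
  have eVd : Function.update (Function.update T a (0, k)) b (2, k) d = (2, k + t) := by rw [Function.update_of_ne hbd.symm, e_d]
  -- C5: the unit shadow of `V'` at `d` is absent (`n3_tags` at the charge-2 letter `b`)
  have C5 : ¬ vN (Function.update (Function.update (Function.update T a (0, k)) b (2, k)) d
      (1, (Function.update (Function.update T a (0, k)) b (2, k) d).2)) := by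
    rw [eVd]
    intro hN
    have := M.n3_tags (g := b) (a := c) (b := d) (f := a) hbc hbd hab.symm hcd hac.symm had.symm hN
      (by rw [Function.update_of_ne hbd, eVb]; omega) (by rw [Function.update_of_ne hbd, eVb]; push_cast; omega)
      (one_le_of_eq_one (by rw [Function.update_of_ne hcd, eVc])) (one_le_of_eq_one (by rw [Function.update_self]))
      (by rw [Function.update_of_ne had, eVa])
    rw [Function.update_of_ne hcd, eVc, Function.update_self] at this
    exact hkt this.symm
  -- C7: `two_sibling` kills `V'[d ≔ (1,k)]`
  have C7 : ¬ vP (Function.update (Function.update (Function.update T a (0, k)) b (2, k)) d (1, k)) :=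
    M.two_sibling hV' (s := d) (f := a) had eVa (by rw [eVd]) C5 (by rw [eVd]; exact fun e => hkt e.symm)
  -- C8: `W`
  have hW := M.w_of hh hN000 hab hac had hbc hbd hcd (k := k)
    (by rw [Function.update_of_ne had, ha]) (by rw [Function.update_of_ne hbd, hb]) (by rw [Function.update_of_ne hcd, hc])
    (by rw [Function.update_self]) (V := Function.update (Function.update (Function.update T a (0, k)) b (2, k)) d (1, k))
    (by rw [Function.update_of_ne had, eVa]) (by rw [Function.update_of_ne hbd, eVb]) (by rw [Function.update_of_ne hcd, eVc])
    (by rw [Function.update_self]) C7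
  -- C9: raise `d` in `N'`: charge exactly `3` gives `Z`
  obtain ⟨c₂, h2lt, h2le, hZ, -⟩ := M.raise3 hh hN' (g := d) (a := b) (b := c) (f := a) hbd.symm hcd.symm had.symm hbc hab.symm
    hac.symm (one_le_of_eq_two (by rw [e_d])) (one_le_of_eq_one (by rw [e_b])) (one_le_of_eq_one (by rw [e_c])) e_a
  rw [show (Function.update T a (0, k) d).1 = 2 by rw [e_d]] at h2lt
  have hc₂ : c₂ = 3 := by omega
  subst hc₂
  rw [show (Function.update T a (0, k) d).2 = k + t by rw [e_d]] at hZ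
  -- C10
  exact M.z_absent hh hW hab hac had hbc hbd hcd (k := k) (t := t) (by rw [Function.update_self])
    (by rw [Function.update_of_ne hab.symm, Function.update_of_ne hbd, hb])
    (by rw [Function.update_of_ne hac.symm, Function.update_of_ne hcd, hc])
    (by rw [Function.update_of_ne had.symm, Function.update_self]) ht
    (by rw [Function.update_of_ne had, Function.update_self]) (by rw [Function.update_of_ne hbd, e_b])
    (by rw [Function.update_of_ne hcd, e_c]) (by rw [Function.update_self]) hZ

/-- **THE `000t` ODD UNIT CELLS ARE ABSENT below twelve (PROVED)**: `U = P[1_k,1_k,1_k,1_{k+t}]` with `t` odd (`t ≠ 0`, `2t ≠ 0`).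
Chain (15 rule steps): `N001 = U[a ≔ apex]`, `N000 = U[d ≔ apex]` (unit hubs); raising `b` in `N001` lands at charge `2` (`V`);
`unit_sibling` kills `V[d ≔ 1_k]`, so `w_of` gives `W = N000[a ≔ 3_k]` and `z_absent` kills `Z = N001[d ≔ 3_{k+t}]`; hence raising `d` in
`N001` lands at charge `2` (`Q`).  On the other side `N21 = V[c ≔ apex]` raises `b` to charge `3` (`R`; charge `4` is a `top3_sibling4`
sibling), `unit_sibling` on `R` kills `R[d ≔ 1_{k−t}]` (here `2t ≠ 0` is used), so `N21[d ≔ 1_{k−t}]` is absent (both its raises are dead) —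
but that cell is `Q[b ≔ apex]` swapped and shifted by `−t`, which RD-P at the unit `b` of `Q` makes present. -/
theorem units4_odd_absent (M : LineModel h vN vP) (hh : h < 12) {U : ACell} (hU : vP U) {a b c d : Fin 4} (hab : a ≠ b)
    (hac : a ≠ c) (had : a ≠ d) (hbc : b ≠ c) (hbd : b ≠ d) (hcd : c ≠ d) (ha1 : (U a).1 = 1) (hb1 : (U b).1 = 1)
    (hc1 : (U c).1 = 1) (hd1 : (U d).1 = 1) (hb2 : (U b).2 = (U a).2) (hc2 : (U c).2 = (U a).2) (hne : (U d).2 ≠ (U a).2)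
    (hodd : (U d).2 - (U a).2 + ((U d).2 - (U a).2) ≠ 0) : False := by
  set k : Fin 4 := (U a).2 with hk
  set t : Fin 4 := (U d).2 - k with htk
  have ht : t ≠ 0 := fun e => hne (sub_eq_zero.mp e)
  have hkt : k + t ≠ k := fin4_add_ne_of_ne_zero k t ht
  have hkmt : k + -t ≠ k + t := fin4_add_neg_ne_add k t hodd
  have hkm : k + -t ≠ k := fin4_add_neg_ne_of_ne_zero k t ht
  have ha : U a = (1, k) := Prod.ext ha1 rfl
  have hb : U b = (1, k) := Prod.ext hb1 hb2
  have hc : U c = (1, k) := Prod.ext hc1 hc2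
  have hd : U d = (1, k + t) := Prod.ext hd1 (by rw [htk]; abel)
  -- S1: the two unit hubs
  have hN001 := M.unit_hub hU ha1 k
  have hN000 := M.unit_hub hU hd1 0
  have e1b : Function.update U a (0, k) b = (1, k) := by rw [Function.update_of_ne hab.symm, hb]
  have e1c : Function.update U a (0, k) c = (1, k) := by rw [Function.update_of_ne hac.symm, hc]
  have e1d : Function.update U a (0, k) d = (1, k + t) := by rw [Function.update_of_ne had.symm, hd]
  have e1a : (Function.update U a (0, k) a).1 = 0 := by rw [Function.update_self]
  -- S2: raise `b` in `N001` to exactly `2`: `V`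
  obtain ⟨c₁, h1lt, h1le, hV, h1t⟩ := M.raise3 hh hN001 (g := b) (a := c) (b := d) (f := a) hbc hbd hab.symm hcd hac.symm had.symm
    (one_le_of_eq_one (by rw [e1b])) (one_le_of_eq_one (by rw [e1c])) (one_le_of_eq_one (by rw [e1d])) e1a
  rw [show (Function.update U a (0, k) b).1 = 1 by rw [e1b]] at h1lt
  have hc₁ : c₁ = 2 := by
    rcases (by omega : c₁ = 2 ∨ c₁ = 3) with e | e
    · exact e
    · exfalso; have := h1t e; rw [e1c, e1d] at this; exact hkt this.symm
  subst hc₁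
  rw [show (Function.update U a (0, k) b).2 = k by rw [e1b]] at hV
  have eVa : (Function.update (Function.update U a (0, k)) b (2, k) a).1 = 0 := by
    rw [Function.update_of_ne hab, Function.update_self]
  have eVb : Function.update (Function.update U a (0, k)) b (2, k) b = (2, k) := by rw [Function.update_self]
  have eVc : Function.update (Function.update U a (0, k)) b (2, k) c = (1, k) := by rw [Function.update_of_ne hbc.symm, e1c]
  have eVd : Function.update (Function.update U a (0, k)) b (2, k) d = (1, k + t) := by rw [Function.update_of_ne hbd.symm, e1d]
  -- S3: `unit_sibling` kills `V[d ≔ (1,k)]`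
  have S3 : ¬ vP (Function.update (Function.update (Function.update U a (0, k)) b (2, k)) d (1, k)) :=
    M.unit_sibling hV (s := d) (f := a) had eVa (by rw [eVd]) (by rw [eVd]; exact fun e => hkt e.symm)
  -- S4: `W`
  have hW := M.w_of hh hN000 hab hac had hbc hbd hcd (k := k)
    (by rw [Function.update_of_ne had, ha]) (by rw [Function.update_of_ne hbd, hb]) (by rw [Function.update_of_ne hcd, hc])
    (by rw [Function.update_self]) (V := Function.update (Function.update (Function.update U a (0, k)) b (2, k)) d (1, k))
    (by rw [Function.update_of_ne had, eVa]) (by rw [Function.update_of_ne hbd, eVb]) (by rw [Function.update_of_ne hcd, eVc])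
    (by rw [Function.update_self]) S3
  -- S9/S10: raise `d` in `N001`: charge `3` is `Z` (absent by `z_absent`), so it lands at charge `2`: `Q`
  obtain ⟨c₂, h2lt, h2le, hQ, -⟩ := M.raise3 hh hN001 (g := d) (a := b) (b := c) (f := a) hbd.symm hcd.symm had.symm hbc hab.symm
    hac.symm (one_le_of_eq_one (by rw [e1d])) (one_le_of_eq_one (by rw [e1b])) (one_le_of_eq_one (by rw [e1c])) e1a
  rw [show (Function.update U a (0, k) d).1 = 1 by rw [e1d]] at h2lt
  rw [show (Function.update U a (0, k) d).2 = k + t by rw [e1d]] at hQ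
  have hc₂ : c₂ = 2 := by
    rcases (by omega : c₂ = 2 ∨ c₂ = 3) with e | e
    · exact e
    · exfalso; subst e
      exact M.z_absent hh hW hab hac had hbc hbd hcd (k := k) (t := t) (by rw [Function.update_self])
        (by rw [Function.update_of_ne hab.symm, Function.update_of_ne hbd, hb])
        (by rw [Function.update_of_ne hac.symm, Function.update_of_ne hcd, hc])
        (by rw [Function.update_of_ne had.symm, Function.update_self]) ht
        (by rw [Function.update_of_ne had, Function.update_self]) (by rw [Function.update_of_ne hbd, e1b])
        (by rw [Function.update_of_ne hcd, e1c]) (by rw [Function.update_self]) hQ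
  subst hc₂
  -- S11: `N21 = V[c ≔ apex]`
  have hN21 := M.unit_hub hV (s := c) (by rw [eVc]) 0
  have e2a : (Function.update (Function.update (Function.update U a (0, k)) b (2, k)) c (0, 0) a).1 = 0 := by
    rw [Function.update_of_ne hac, eVa]
  have e2b : Function.update (Function.update (Function.update U a (0, k)) b (2, k)) c (0, 0) b = (2, k) := by
    rw [Function.update_of_ne hbc, eVb]
  have e2c : (Function.update (Function.update (Function.update U a (0, k)) b (2, k)) c (0, 0) c).1 = 0 := by
    rw [Function.update_self]
  have e2d : Function.update (Function.update (Function.update U a (0, k)) b (2, k)) c (0, 0) d = (1, k + t) := by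
    rw [Function.update_of_ne hcd.symm, eVd]
  -- the charge-4 siblings `[apex@a, 4_k@b, apex@c, 1_j@d]` (`j ≠ k`) are dead: slots permuted they are `top3_sibling4` siblings of `W`
  have S7 : ∀ (Y : ACell) (j : Fin 4), j ≠ k → (Y a).1 = 0 → Y b = (4, k) → (Y c).1 = 0 → Y d = (1, j) → ¬ vP Y := by
    intro Y j hj hYa hYb hYc hYd hY
    have hS := M.permP _ (M.permP _ hY (Equiv.swap a b)) (Equiv.swap c d)
    refine M.top3_sibling4 hh hW (g := a) (b := b) (c := c) hab hac hbc (by rw [Function.update_self])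
      (by rw [Function.update_of_ne hab.symm, Function.update_of_ne hbd, hb]) (by rw [Function.update_of_ne hac.symm,
        Function.update_of_ne hcd, hc]) hj (M.congrP hS (fun i => ?_))
    rcases fin4_cover hab hac had hbc hbd hcd i with hi | hi | hi | hi <;> rw [hi]
    · left
      rw [Equiv.swap_apply_of_ne_of_ne hac had, Equiv.swap_apply_left, hYb, Function.update_of_ne hac, Function.update_self]
    · right
      rw [Equiv.swap_apply_of_ne_of_ne hbc hbd, Equiv.swap_apply_right, Function.update_of_ne hbc,
        Function.update_of_ne (Ne.symm hab), Function.update_self]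
      exact ⟨hYa, rfl⟩
    · left
      rw [Equiv.swap_apply_left, Equiv.swap_apply_of_ne_of_ne had.symm hbd.symm, hYd, Function.update_self]
    · right
      rw [Equiv.swap_apply_right, Equiv.swap_apply_of_ne_of_ne hac.symm hbc.symm, Function.update_of_ne hcd.symm,
        Function.update_of_ne had.symm, Function.update_of_ne hbd.symm, Function.update_of_ne had.symm, Function.update_self]
      exact ⟨hYc, rfl⟩
  -- S12: raise `b` in `N21` to exactly `3`: `R`
  obtain ⟨c₃, h3lt, h3le, hR⟩ := M.raise2 hh hN21 (g := b) (b := d) hbd (one_le_of_eq_two (by rw [e2b]))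
    (one_le_of_eq_one (by rw [e2d]))
  rw [show (Function.update (Function.update (Function.update U a (0, k)) b (2, k)) c (0, 0) b).1 = 2 by rw [e2b]] at h3lt
  rw [show (Function.update (Function.update (Function.update U a (0, k)) b (2, k)) c (0, 0) b).2 = k by rw [e2b]] at hR
  have hc₃ : c₃ = 3 := by
    rcases (by omega : c₃ = 3 ∨ c₃ = 4) with e | e
    · exact e
    · exfalso; subst e
      exact S7 _ (k + t) (fun e => hkt e) (by rw [Function.update_of_ne hab, e2a]) (by rw [Function.update_self])
        (by rw [Function.update_of_ne (Ne.symm hbc), e2c]) (by rw [Function.update_of_ne hbd.symm, e2d]) hR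
  subst hc₃
  -- S13: `unit_sibling` on `R` kills `R[d ≔ (1, k−t)]`
  have S13 : ¬ vP (Function.update (Function.update (Function.update (Function.update (Function.update U a (0, k)) b (2, k))
      c (0, 0)) b (3, k)) d (1, k + -t)) :=
    M.unit_sibling hR (s := d) (f := a) had (by rw [Function.update_of_ne hab, e2a]) (by rw [Function.update_of_ne hbd.symm, e2d])
      (by rw [Function.update_of_ne hbd.symm, e2d]; exact hkmt)
  -- S14: `Nx = N21[d ≔ (1, k−t)]` is absent: its raises of `b` are `R[d ≔ 1_{k−t}]` (S13) and a charge-4 sibling (S7)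
  have S14 : ¬ vN (Function.update (Function.update (Function.update (Function.update U a (0, k)) b (2, k)) c (0, 0)) d
      (1, k + -t)) := by
    intro hNx
    obtain ⟨c₄, h4lt, h4le, hP⟩ := M.raise2 hh hNx (g := b) (b := d) hbd
      (one_le_of_eq_two (by rw [Function.update_of_ne hbd, e2b])) (one_le_of_eq_one (by rw [Function.update_self]))
    have e4b : Function.update (Function.update (Function.update (Function.update U a (0, k)) b (2, k)) c (0, 0)) d
        (1, k + -t) b = (2, k) := by rw [Function.update_of_ne hbd, e2b]
    rw [show (Function.update (Function.update (Function.update (Function.update U a (0, k)) b (2, k)) c (0, 0)) d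
        (1, k + -t) b).1 = 2 by rw [e4b]] at h4lt
    rw [show (Function.update (Function.update (Function.update (Function.update U a (0, k)) b (2, k)) c (0, 0)) d
        (1, k + -t) b).2 = k by rw [e4b]] at hP
    rcases (by omega : c₄ = 3 ∨ c₄ = 4) with e | e
    · subst e
      rw [Function.update_comm hbd.symm] at hP
      exact S13 hP
    · subst e
      exact S7 _ (k + -t) hkm (by rw [Function.update_of_ne hab, Function.update_of_ne had, e2a]) (by rw [Function.update_self])
        (by rw [Function.update_of_ne (Ne.symm hbc), Function.update_of_ne hcd, e2c])
        (by rw [Function.update_of_ne hbd.symm, Function.update_self]) hP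
  -- S15: RD-P at the unit `b` of `Q`, swapped and shifted by `−t`, is `Nx`
  have hN'' := M.unit_hub hQ (s := b) (by rw [Function.update_of_ne hbd, e1b]) 0
  have hS := M.shiftN_by (M.permN _ (M.permN _ hN'' (Equiv.swap b d)) (Equiv.swap c d)) (-t)
  refine S14 (M.congrN hS (fun i => ?_))
  dsimp only
  rcases fin4_cover hab hac had hbc hbd hcd i with hi | hi | hi | hi <;> rw [hi]
  · right
    rw [Equiv.swap_apply_of_ne_of_ne hac had, Equiv.swap_apply_of_ne_of_ne hab had, Function.update_of_ne hab,
      Function.update_of_ne had, e1a, Function.update_of_ne had, e2a]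
    exact ⟨rfl, rfl⟩
  · left
    rw [Equiv.swap_apply_of_ne_of_ne hbc hbd, Equiv.swap_apply_left, Function.update_of_ne (Ne.symm hbd), Function.update_self,
      Function.update_of_ne hbd, e2b]
    exact Prod.ext rfl (fin4_add_add_neg k t)
  · right
    rw [Equiv.swap_apply_left, Equiv.swap_apply_right, Function.update_self, Function.update_of_ne hcd, e2c]
    exact ⟨rfl, rfl⟩
  · left
    rw [Equiv.swap_apply_right, Equiv.swap_apply_of_ne_of_ne (Ne.symm hbc) hcd, Function.update_of_ne (Ne.symm hbc),
      Function.update_of_ne hcd, e1c, Function.update_self]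

end LineModel

/-- the shape of an odd tag word (finite check): there is a slot `s` such that the other three tags are all equal and `x s` differs from
them by an odd amount (type `000t`), or two of the other three are antipodal and `x s` lies outside that antipodal class (types
`0012 ∕ 0023`, up to shift). -/
theorem odd_unit_tags_aux : ∀ x0 x1 x2 x3 : Fin 4, (x0.val % 2 + x1.val % 2 + x2.val % 2 + x3.val % 2) % 2 = 1 →
    ∃ s : Fin 4,
      (![x0, x1, x2, x3] (s + 2) = ![x0, x1, x2, x3] (s + 1) ∧ ![x0, x1, x2, x3] (s + 3) = ![x0, x1, x2, x3] (s + 1) ∧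
          ![x0, x1, x2, x3] s ≠ ![x0, x1, x2, x3] (s + 1) ∧
          ![x0, x1, x2, x3] s - ![x0, x1, x2, x3] (s + 1) + (![x0, x1, x2, x3] s - ![x0, x1, x2, x3] (s + 1)) ≠ 0) ∨
      (![x0, x1, x2, x3] (s + 3) = ![x0, x1, x2, x3] (s + 1) + 2 ∧ ![x0, x1, x2, x3] s ≠ ![x0, x1, x2, x3] (s + 1) ∧
          ![x0, x1, x2, x3] s ≠ ![x0, x1, x2, x3] (s + 1) + 2) ∨
      (![x0, x1, x2, x3] (s + 3) = ![x0, x1, x2, x3] (s + 2) + 2 ∧ ![x0, x1, x2, x3] s ≠ ![x0, x1, x2, x3] (s + 2) ∧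
          ![x0, x1, x2, x3] s ≠ ![x0, x1, x2, x3] (s + 2) + 2) ∨
      (![x0, x1, x2, x3] (s + 2) = ![x0, x1, x2, x3] (s + 1) + 2 ∧ ![x0, x1, x2, x3] s ≠ ![x0, x1, x2, x3] (s + 1) ∧
          ![x0, x1, x2, x3] s ≠ ![x0, x1, x2, x3] (s + 1) + 2) := by
  decide

/-- `odd_unit_tags` (Part J; tree copy, statement verbatim). -/
theorem odd_unit_tags (x : Fin 4 → Fin 4) (hx : ((x 0).val % 2 + (x 1).val % 2 + (x 2).val % 2 + (x 3).val % 2) % 2 = 1) :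
    ∃ s : Fin 4,
      (x (s + 2) = x (s + 1) ∧ x (s + 3) = x (s + 1) ∧ x s ≠ x (s + 1) ∧ x s - x (s + 1) + (x s - x (s + 1)) ≠ 0) ∨
      (x (s + 3) = x (s + 1) + 2 ∧ x s ≠ x (s + 1) ∧ x s ≠ x (s + 1) + 2) ∨
      (x (s + 3) = x (s + 2) + 2 ∧ x s ≠ x (s + 2) ∧ x s ≠ x (s + 2) + 2) ∨
      (x (s + 2) = x (s + 1) + 2 ∧ x s ≠ x (s + 1) ∧ x s ≠ x (s + 1) + 2) := by
  have e : ![x 0, x 1, x 2, x 3] = x := by funext i; fin_cases i <;> rfl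
  have := odd_unit_tags_aux (x 0) (x 1) (x 2) (x 3) hx
  rw [e] at this
  exact this

/-- **THE UNIT NUCLEUS IS EMPTY BELOW TWELVE (PROVED, h-uniform)** — formerly the one MACHINE input of the odd threshold law
(`UNITPROBE-h10.txt`; `L10-G1` LRAT ×2 + the critic's replay): every odd unit cell is of type `000t` (`units4_odd_absent`) or of antipodal type
(`unitP_antipodal_absent`), and every `(2;1,1,1)` odd cell is `two_units3_absent`. -/
theorem abstractOddUnitNucleusFree_of_lt_twelve {h : ℤ} (hh : h < 12) : AbstractOddUnitNucleusFree h := by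
  intro vN vP M X hodd hshape hX
  obtain ⟨hc, hpar⟩ := hodd
  rcases hshape with hunit | ⟨g, hg2, hg1, hgt⟩
  · obtain ⟨s, hs⟩ := odd_unit_tags (fun i => (X i).2) hpar
    obtain ⟨h1, h2, h3, h12, h13, h23⟩ := fin4_others s
    rcases hs with ⟨e2, e3, hne, hodd2⟩ | ⟨e3, hne, hne2⟩ | ⟨e3, hne, hne2⟩ | ⟨e2, hne, hne2⟩
    · exact M.units4_odd_absent hh hX h12 h13 h1 h23 h2 h3 (hunit _) (hunit _) (hunit _) (hunit _) e2 e3 hne hodd2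
    · exact M.unitP_antipodal_absent hh hX (a := s + 1) (b := s) (c := s + 3) (d := s + 2) h1 h13 h12 h3.symm h2.symm h23.symm
        (hunit _) (hunit _) (hunit _) (hunit _) e3 hne hne2
    · exact M.unitP_antipodal_absent hh hX (a := s + 2) (b := s) (c := s + 3) (d := s + 1) h2 h23 h12.symm h3.symm h1.symm
        h13.symm (hunit _) (hunit _) (hunit _) (hunit _) e3 hne hne2
    · exact M.unitP_antipodal_absent hh hX (a := s + 1) (b := s) (c := s + 2) (d := s + 3) h1 h12 h13 h2.symm h3.symm h23
        (hunit _) (hunit _) (hunit _) (hunit _) e2 hne hne2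
  · obtain ⟨h1, h2, h3, h12, h13, h23⟩ := fin4_others g
    have hne : (X g).2 ≠ (X (g + 1)).2 := by
      intro e
      have all : ∀ i, (X i).2 = (X (g + 1)).2 := by
        intro i
        by_cases hi : i = g
        · rw [hi]; exact e
        · exact hgt i (g + 1) hi h1
      rw [all 0, all 1, all 2, all 3] at hpar
      omega
    exact M.two_units3_absent hh hX (a := g + 1) (b := g + 2) (c := g + 3) (d := g) h12 h13 h1 h23 h2 h3 (hg1 _ h1) (hg1 _ h2)
      (hg1 _ h3) hg2 (hgt _ _ h2 h1) (hgt _ _ h3 h1) hne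

/-- **NO ODD FC BELOW TWELVE, abstractly (PROVED, h-uniform)** — `AbstractOddFree h` for every `h < 12`; sharp (`not_abstractOddFree_of_twelve_le`). -/
theorem abstractOddFree_of_lt_twelve {h : ℤ} (hh : h < 12) : AbstractOddFree h :=
  abstractOddFree_of_unitNucleus hh (abstractOddUnitNucleusFree_of_lt_twelve hh)

/-- **`(OL_h)` FOR EVERY `h < 12` (PROVED, sorry-free, uniformly in `h`)**: no `G₁`-closed RULE-D∕`X+` design supported on two adjacent LINE
alphabets of height `< 12` has an odd fully charged cell.  All four W-LINE «odd FC» rows of the census below twelve (LINE-8, LINE-10 UNSAT: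
j326579 ∕ j326707; and the odd heights) are now KERNEL consequences of the four closed forms; LINE-12 SAT is `not_oddFCFreeLine_twelve`. -/
theorem oddFCFreeLine_of_lt_twelve {h : ℤ} (hh : h < 12) : OddFCFreeLine h :=
  oddFCFreeLine_of_abstract (abstractOddFree_of_lt_twelve hh)

/-- **THE ODD THRESHOLD LAW ON THE LINE IS A THEOREM** (PROVED outright, sorry-free): `(∀ h ≤ 10, OddFCFreeLine h) ∧ ¬ OddFCFreeLine 12`. -/
theorem oddLineThresholdLaw_holds : OddLineThresholdLaw :=
  oddLineThresholdLaw_of_unitNucleus (abstractOddUnitNucleusFree_of_lt_twelve (by norm_num))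

end Summit.Ventures.HSemireg.Pad4Tower.LinePhaseRigidity
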